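import Summits.QuantumFields.YangMills.Theorems.BalabanUVNodesN22AtRecordOfPrintedSlots
import Summits.QuantumFields.YangMills.Theorems.BalabanUVNodesN22WindowedNE9DichotomyLetter

/-!
# NODE N22 (NE9) — LETTER-LEVEL PASSAGES AT THE RECORD for K3⁷ v5 §2b's `h9` and the N22 pin face, and J33's (β′) letter («printed (2.38) + OLDER activity margins
# + an OUTPUT-level last-coupling letter») READ AT THE RECORD — «J33-at-record»

Cell `pub-ymgap`, Track A (HUMAN RULING D-0062), WIDTH SEAT `dag-n22-w5` (g0) on node n22 = NE9, D-0154 (3a) second width wave; `--kind proof --supports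
stmt-QuantumFields-20544 --as helper` (K3⁷ `SpineGivenEndpointR13SepCoPH`, skeleton v5 941dddb108cbaacf), COUNT-NEUTRAL; THEOREMS ONLY (0 `def`, 0 `sorry`, standard axioms).
dag-n22-c g13's hand «w5 take J33-at-record» (pub-ymgap INBOX 2026-08-28T06:24:59Z; my YES l.30355; CLAIM-3 ∕ INTENT-4 l.30927) — «one application of W1-19b
`windowedNE9OfRecord₁₃_iff_of_localizes` + the pin faces».  Nothing of (A)∕(B)∕J31∕J32′∕J33∕p593053 is re-declared; every step is plain application.

WHAT.
* §1 LETTER-LEVEL PASSAGES (generic; the configuration type `𝔸` of the towers is instance-FREE, the reading algebra is `MatA N`): ★ `ne9_EA_objectsOfRecord₁₃_of_letterOfRecord` —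
  W1-19b's letter of record `WindowedNE9OfRecord₁₃ F N θ δ Λ′` + `ℓ.Signs` + `PolLimitsExistOfRecord₁₃ F N θ` + domination `ℓ.κ ≤ δ`, `Λ′ ≤ ℓ.moduli` ⟹ K3⁷ v5 §2b's
  `h9 : NE9 ((objectsOfRecord₁₃ F N θ ℓ).EA 0) (Window θ.γ) ℓ.κ ℓ.moduli` (the five lines dag-n22-w2's (B) §2 inlines: (A) §1b `windowedNE9_of_le` + W1-19b `windowedNE9OfRecord₁₃_iff` +
  dag-n22-w3's (1.21) passage `n22At_u3OfRecord₁₃_objectsOfRecord₁₃_of_windowed`, named once); ★ `ne9_EA_objectsOfRecord₁₃_of_windowedLetter` — ANY (β′) letter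
  `WindowedNE9 F (localizedSum F S emb) θ.ρ8 θ.bV (Window θ.γ) δ Λ′` for towers `S` and a reading `emb` with W1-20's law `Localizes17OfRecord₁₃ F N θ S emb` ⟹ `h9`
  (`windowedNE9OfRecord₁₃_iff_of_localizes`, then the first); ★ `n22At_rateCarriers_of_kernels_pin_of_letterOfRecord` ∕ ★ `n22At_rateCarriers_of_kernels_pin_of_windowedLetter` — the N22
  pin face `N22At (rateCarriersOfRecord₁₃CoPH 𝔯 F θ hP g₀ os k).u3` for EVERY `k` under `hpin`, from either letter (dag-n22-w3's `n22At_rateCarriers_of_kernels_pin_of_ne9`).  So every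
  producer of a (β′) letter at a localizing reading — (A), J32′ §2∕§2b∕§3, J33-2∕-3, future ones — reaches §2b's `h9` and the pin face by ONE application.
* §2 J33 AT THE RECORD: ★★★ `ne9_EA_objectsOfRecord₁₃_of_olderCoordHolo_lastLetter_analyticH` ∕ ★★★ `n22At_rateCarriers_of_kernels_pin_of_olderCoordHolo_lastLetter_analyticH` —
  dag-n22-c g13's (β′) letter `windowedNE9_localizedSum_of_olderCoordHolo_lastLetter` (J33-2: printed (2.38) on the boxes + OLDER-coordinate activity margins `hO` (radii `ϱt`) + ONE
  OUTPUT-level last-coupling Lipschitz letter `hlast` (constant `ΛE`, rate `κ`; node N09's ∕ [I] p. 263's clause) + J30's engine) at `W := Window θ.γ`, `ρ := θ.ρ8`, `bV := θ.bV`,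
  with its activity-holomorphy binder `hHhol` DISCHARGED by J32′ §1 `differentiableOn_H_comp_of_analyticH` from W1's PRINTED `AnalyticH (box θ.γ k)` + holomorphic readings, then §1;
  letter rows over J33's g-independent table `C_E · (if i + 1 < n then 8(e·9·64·K₀(64,8)²)·(4A∕ϱt n i) else ΛE)`, `C_E = (16B₃²∕r²)·exp(12Mδ₁)·K₀(64,8)·K₁(4,δ₀∕2)`.
  DISPLAYED INPUTS after §2: law `Localizes17OfRecord₁₃`; printed (2.38) on the boxes (N10); OLDER-coordinate activity margins (N10's T-row complexified ∕ NODE A — NOT PRINTED as such);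
  ONE output-level last-coupling letter `hlast` (node N09's `EHoloAt` families discharge it via J33-1 §3 ∕ J33-3 when landed; the cell's reading of [I] p. 263, NOT a printed
  estimate); PRINTED `AnalyticH`; readings with chart∕space clauses; site weights with tails ([I] p. 282); numerals; `PolLimitsExistOfRecord₁₃` (dag-n22-w3's road ∕
  `…PrintedSlotsClosed`'s discharge); letter rows.  A5∕A6: J33-1 `lastLetter_termlessStep`, J31 `coordHolo_termlessStep`, `analyticH_termlessStep` and dag-n22-w2's
  `…AtSlotsInhabited` inhabit the non-record hypotheses at the EMPTY towers (DEGENERATE, declared); the law, `PolLimitsExistOfRecord₁₃`, `θ` and the reading OF RECORD are LOCATED.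

HONEST FRAMING (binding).  Count-neutral COMPOSITION of landed theorems by name; NO estimate of Bałaban's is proved or asserted; every displayed input is a HYPOTHESIS with its
owner; nothing of the record is constructed or claimed to meet them; N22 is NOT discharged (typed 28∕28 · discharged 5∕27 UNCHANGED); K3⁷ OPEN and NOT claimed; NE9 is NOT IN
PRINT for d = 4; no count claim (the chair's single count line is the only count); no summit statement is proved by this seat; one finite 𝕋⁴ programme at fixed ε — R4 closes
the CONDITIONAL rung `BalabanLadder.UV` only; NOTHING about the continuum limit, ℝ⁴, infinite volume, OS axioms, a mass gap or the Clay problem is proved or claimed by any of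
this.  References (TYPES only): [I] = Bałaban, CMP 109 (1987) (1.7) p. 261, §1 p. 263, (1.18) p. 263, (1.20)–(1.21) p. 264, p. 282; [II] = CMP 116 (1988) (2.13)–(2.14) pp. 14–15,
p. 15, (2.38) p. 20, (2.39)–(2.41) p. 21.
-/

noncomputable section

open Filter Topology Metric Set
open scoped BigOperators

namespace YMDAG.N22.AtRecordOfPrintedSlots

open Literature.MathematicalPhysics.QuantumFieldTheory.Balaban1983to89
open Literature.MathematicalPhysics.QuantumFieldTheory.Balaban1983to89.T4Continuum (T4Family ULoop)
open Literature.MathematicalPhysics.QuantumFieldTheory.Balaban1983to89.T4OutputRate (Window NE9)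
open Literature.MathematicalPhysics.QuantumFieldTheory.Balaban1983to89.Node00 (Stage13Params Stage13HParams U3Letters₁₁ MatA)
open Literature.MathematicalPhysics.QuantumFieldTheory.Balaban1983to89.Node00.Sect2 (domCount domSys CPair)
open Literature.MathematicalPhysics.QuantumFieldTheory.Balaban1983to89.Node00.LocalizedSum17 (localizedSum ReadingMaps Localizes17OfRecord₁₃)
open Literature.MathematicalPhysics.QuantumFieldTheory.Balaban1983to89.Node00.W1 (ClusterTower ClusterStep box)
open Literature.MathematicalPhysics.QuantumFieldTheory.Balaban1983to89.Node00.U3OfKernels (histPrefix objectsOfRecord₁₃)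
open Literature.MathematicalPhysics.QuantumFieldTheory.Balaban1983to89.Node00.U3KernelLetters (WindowedNE9 WindowedNE9OfRecord₁₃ PolLimitsExistOfRecord₁₃
  windowedNE9OfRecord₁₃_iff polLimitsExistOfRecord₁₃_iff windowedNE9OfRecord₁₃_iff_of_localizes)
open Literature.MathematicalPhysics.QuantumFieldTheory.Balaban1983to89.B12Decay510 (delta1)
open Literature.MathematicalPhysics.QuantumFieldTheory.Balaban1983to89.B12Decay510Window (K₁)
open Literature.MathematicalPhysics.QuantumFieldTheory.Balaban1983to89.B12Decay510Torus (distCT nearT)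
open Literature.MathematicalPhysics.QuantumFieldTheory.Balaban1983to89.B12TreeDecay (K₀ kappa₀ K₀_pos)
open Literature.MathematicalPhysics.QuantumFieldTheory.Balaban1983to89.TreeLengthTorus (TPt torusTreeLen)
open YMDAG.UVSplit (N22At RateReading₁₃CoPH rateCarriersOfRecord₁₃CoPH)
open YMDAG.N22.AtKernels (n22At_u3OfRecord₁₃_objectsOfRecord₁₃_iff n22At_u3OfRecord₁₃_objectsOfRecord₁₃_of_windowed n22At_rateCarriers_of_kernels_pin_of_ne9)
open YMDAG.N22.WindowSoftTwoPoint (windowedNE9_of_le)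
open YMDAG.N22.WindowedOfCouplingHolo (differentiableOn_H_comp_of_analyticH histPrefix_mem_box)
open YMDAG.N22.Dichotomy (windowedNE9_localizedSum_of_olderCoordHolo_lastLetter)

open scoped Matrix.Norms.L2Operator

variable (F : T4Family) (N : ℕ) [NeZero N]

/-! ## §1 Letter-level passages at the record: W1-19b's letter ∕ any (β′) letter at a localizing reading ⟹ K3⁷ v5 §2b's `h9` and the N22 pin face -/

/-- ★ **FROM W1-19b's LETTER OF RECORD TO K3⁷ v5 §2b's `h9`.**  For a letter block `ℓ` with its signs DOMINATING the letter's constants (`ℓ.κ ≤ δ`, `Λ′ ≤ ℓ.moduli` entrywise),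
`WindowedNE9OfRecord₁₃ F N θ δ Λ′` and the (1.21) existence `PolLimitsExistOfRecord₁₃ F N θ` give kernel-currency NE9 of the run-A functional OF RECORD on the window with the letters'
rate and moduli — (A) §1b `windowedNE9_of_le` + W1-19b `windowedNE9OfRecord₁₃_iff` + dag-n22-w3's (1.21) passage (p593053).  LOCATED (hypothesis form); N22 NOT discharged. -/
theorem ne9_EA_objectsOfRecord₁₃_of_letterOfRecord (θ : Stage13Params F N) (ℓ : U3Letters₁₁) (hs : ℓ.Signs) (hlim : PolLimitsExistOfRecord₁₃ F N θ)
    {δ : ℝ} {Λ' : ℕ → ℕ → ℝ} (h9 : WindowedNE9OfRecord₁₃ F N θ δ Λ') (hℓκ : ℓ.κ ≤ δ) (hdom : ∀ k i, Λ' k i ≤ ℓ.moduli k i) :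
    NE9 ((objectsOfRecord₁₃ F N θ ℓ).EA 0) (Window θ.γ) ℓ.κ ℓ.moduli := by
  have hmod : ∀ k i, 0 ≤ ℓ.moduli k i := fun k i => by
    rw [U3Letters₁₁.moduli_apply]; exact mul_nonneg hs.C₉_nonneg (pow_nonneg hs.ω_nonneg _)
  have h9' : WindowedNE9OfRecord₁₃ F N θ ℓ.κ ℓ.moduli := by
    letI := θ.instVβ₁; letI := θ.instVβ₂; letI := θ.instιβ
    exact windowedNE9_of_le F _ θ.ρ8 θ.bV h9 hℓκ hdom hmod
  rw [← n22At_u3OfRecord₁₃_objectsOfRecord₁₃_iff F N θ ℓ hs 0]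
  exact n22At_u3OfRecord₁₃_objectsOfRecord₁₃_of_windowed F N θ ℓ hs 0 ((polLimitsExistOfRecord₁₃_iff F N θ).1 hlim)
    ((windowedNE9OfRecord₁₃_iff F N θ _ _).1 h9')

/-- ★ **FROM ANY (β′) LETTER AT A LOCALIZING READING TO `h9`.**  Towers `S K : ClusterTower (F.P K) 𝔸 M` over ANY configuration type `𝔸` and a reading `emb : ReadingMaps F (MatA N) 𝔸`
with W1-20's law `Localizes17OfRecord₁₃ F N θ S emb`: the (β′) letter `WindowedNE9 F (localizedSum F S emb) θ.ρ8 θ.bV (Window θ.γ) δ Λ′`, `ℓ.Signs`, `PolLimitsExistOfRecord₁₃ F N θ` and the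
domination rows give `h9` — W1-19b `windowedNE9OfRecord₁₃_iff_of_localizes`, then `ne9_EA_objectsOfRecord₁₃_of_letterOfRecord`.  LOCATED (hypothesis form); N22 NOT discharged. -/
theorem ne9_EA_objectsOfRecord₁₃_of_windowedLetter (θ : Stage13Params F N) (ℓ : U3Letters₁₁) (hs : ℓ.Signs) (hlim : PolLimitsExistOfRecord₁₃ F N θ)
    {𝔸 : Type*} {M : ℕ} (S : (K : ℕ) → ClusterTower (F.P K) 𝔸 M) (emb : ReadingMaps F (MatA N) 𝔸) (hloc : Localizes17OfRecord₁₃ F N θ S emb)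
    {δ : ℝ} {Λ' : ℕ → ℕ → ℝ}
    (h : letI := θ.instVβ₁; letI := θ.instVβ₂; letI := θ.instιβ
      WindowedNE9 F (localizedSum F S emb) θ.ρ8 θ.bV (Window θ.γ) δ Λ')
    (hℓκ : ℓ.κ ≤ δ) (hdom : ∀ k i, Λ' k i ≤ ℓ.moduli k i) :
    NE9 ((objectsOfRecord₁₃ F N θ ℓ).EA 0) (Window θ.γ) ℓ.κ ℓ.moduli :=
  ne9_EA_objectsOfRecord₁₃_of_letterOfRecord F N θ ℓ hs hlim ((windowedNE9OfRecord₁₃_iff_of_localizes F N θ S emb hloc _ _).2 h) hℓκ hdom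

/-- ★ **THE N22 PIN FACE FROM W1-19b's LETTER OF RECORD**, every run length `k`, at a Stage-13 rate reading whose node-U3 objects at the tuple ARE the kernel objects of record
(`hpin`) — `ne9_EA_objectsOfRecord₁₃_of_letterOfRecord` fed to dag-n22-w3's `n22At_rateCarriers_of_kernels_pin_of_ne9` (= K3⁷ v5 §2b `n22At_rrOfRecord_of_pinned` at the selector's value).
LOCATED (hypothesis form); N22 NOT discharged. -/
theorem n22At_rateCarriers_of_kernels_pin_of_letterOfRecord (𝔯 : RateReading₁₃CoPH N) (θ : Stage13HParams F N) (hP : θ.Provisos₁₃CoPH F N)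
    (g₀ : ℕ → ℝ) (os : List (ULoop F)) (ℓ : U3Letters₁₁) (hs : ℓ.Signs) (hpin : (𝔯.lit F θ hP g₀ os).u3 = objectsOfRecord₁₃ F N θ.toStage13Params ℓ)
    (hlim : PolLimitsExistOfRecord₁₃ F N θ.toStage13Params) {δ : ℝ} {Λ' : ℕ → ℕ → ℝ} (h9 : WindowedNE9OfRecord₁₃ F N θ.toStage13Params δ Λ')
    (hℓκ : ℓ.κ ≤ δ) (hdom : ∀ k i, Λ' k i ≤ ℓ.moduli k i) (k : ℕ) :
    N22At (rateCarriersOfRecord₁₃CoPH 𝔯 F θ hP g₀ os k).u3 :=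
  n22At_rateCarriers_of_kernels_pin_of_ne9 𝔯 θ hP g₀ os ℓ hs hpin
    (ne9_EA_objectsOfRecord₁₃_of_letterOfRecord F N θ.toStage13Params ℓ hs hlim h9 hℓκ hdom) k

/-- ★ **THE N22 PIN FACE FROM ANY (β′) LETTER AT A LOCALIZING READING**, every run length `k`, under `hpin`.  LOCATED (hypothesis form); N22 NOT discharged. -/
theorem n22At_rateCarriers_of_kernels_pin_of_windowedLetter (𝔯 : RateReading₁₃CoPH N) (θ : Stage13HParams F N) (hP : θ.Provisos₁₃CoPH F N)
    (g₀ : ℕ → ℝ) (os : List (ULoop F)) (ℓ : U3Letters₁₁) (hs : ℓ.Signs) (hpin : (𝔯.lit F θ hP g₀ os).u3 = objectsOfRecord₁₃ F N θ.toStage13Params ℓ)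
    (hlim : PolLimitsExistOfRecord₁₃ F N θ.toStage13Params)
    {𝔸 : Type*} {M : ℕ} (S : (K : ℕ) → ClusterTower (F.P K) 𝔸 M) (emb : ReadingMaps F (MatA N) 𝔸) (hloc : Localizes17OfRecord₁₃ F N θ.toStage13Params S emb)
    {δ : ℝ} {Λ' : ℕ → ℕ → ℝ}
    (h : letI := θ.instVβ₁; letI := θ.instVβ₂; letI := θ.instιβ
      WindowedNE9 F (localizedSum F S emb) θ.ρ8 θ.bV (Window θ.γ) δ Λ')
    (hℓκ : ℓ.κ ≤ δ) (hdom : ∀ k i, Λ' k i ≤ ℓ.moduli k i) (k : ℕ) :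
    N22At (rateCarriersOfRecord₁₃CoPH 𝔯 F θ hP g₀ os k).u3 :=
  n22At_rateCarriers_of_kernels_pin_of_ne9 𝔯 θ hP g₀ os ℓ hs hpin
    (ne9_EA_objectsOfRecord₁₃_of_windowedLetter F N θ.toStage13Params ℓ hs hlim S emb hloc h hℓκ hdom) k

/-! ## §2 J33's (β′) letter READ AT THE RECORD (activity holomorphy from PRINTED `AnalyticH`) -/

open Classical in
/-- ★★★ **K3⁷ v5 §2b's `h9` FROM PRINTED (2.38) + OLDER ACTIVITY MARGINS + AN OUTPUT-LEVEL LAST-COUPLING LETTER** (J33 at the record).  Towers `S K : ClusterTower (F.P K) 𝔸 M`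
(`M = L^{m′}`; configuration algebra `𝔸` a normed ℂ-algebra, for PRINTED `AnalyticH`) read through `emb : ReadingMaps F (MatA N) 𝔸` with W1-20's law; per `(K, k)`: `Bound238` on the box,
the OLDER-coordinate margin datum `hO` (radii `ϱt (k+1) i`, `i < k`), the OUTPUT-level last-coupling Lipschitz letter `hlast` (constant `ΛE`, rate `κ`); PRINTED `AnalyticH` on the boxes;
holomorphic readings with chart∕space clauses; site weights with tails; Road 1's numerals; `PolLimitsExistOfRecord₁₃`; a letter block dominating J33's table ⟹
`NE9 ((objectsOfRecord₁₃ F N θ ℓ).EA 0) (Window θ.γ) ℓ.κ ℓ.moduli` — J33-2 `windowedNE9_localizedSum_of_olderCoordHolo_lastLetter` ∘ J32′ §1 ∘ §1.  LOCATED; N22 NOT discharged. -/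
theorem ne9_EA_objectsOfRecord₁₃_of_olderCoordHolo_lastLetter_analyticH (θ : Stage13Params F N) (ℓ : U3Letters₁₁) (hs : ℓ.Signs)
    (hlim : PolLimitsExistOfRecord₁₃ F N θ) {𝔸 : Type*} [NormedRing 𝔸] [NormedAlgebra ℂ 𝔸] (m' : ℕ) (M : ℕ) [NeZero M] (hM : M = F.L ^ m')
    (S : (K : ℕ) → ClusterTower (F.P K) 𝔸 M) (emb : ReadingMaps F (MatA N) 𝔸) (hloc : Localizes17OfRecord₁₃ F N θ S emb)
    (sp : (K k : ℕ) → (domSys (F.P K) M (k + 1)).Dom → Set (CPair (F.P K) 𝔸))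
    {A R r₁ κ δ₀ B₃ r ΛE : ℝ} (ϱt : ℕ → ℕ → ℝ) (hϱt : ∀ n i, 0 < ϱt n i)
    (hA : 0 < A) (hr₁ : 0 ≤ r₁) (hκ : κ ≤ r₁) (hκ₀ : kappa₀ (4 * 2 ^ 4) (2 * 4) ≤ κ / 2) (hrate : r₁ + 2 * (64 * Real.log 162) + 2 ≤ R)
    (hsmall : 2 * A * Real.exp (5 * r₁ + 1) * K₀ 64 8 * 9 * 64 ≤ 1) (hδ₀ : 0 < δ₀) (hB₃ : 0 ≤ B₃) (hr : 0 < r) (hΛE : 0 ≤ ΛE)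
    (h238 : ∀ K k, ((S K) k).Bound238 (box θ.γ k) (sp K k) A R)
    (hO : ∀ (K k : ℕ), ∀ g ∈ box θ.γ k, ∀ (Z : (domSys (F.P K) M (k + 1)).Dom), ∀ φ ∈ sp K k Z, ∀ i : Fin (k + 1), (i : ℕ) < k →
      ∃ (Hc : ℂ → ℂ) (O : Set ℂ), DifferentiableOn ℂ Hc O ∧ (∀ t ∈ Ioc (0 : ℝ) θ.γ, closedBall (t : ℂ) (ϱt (k + 1) i) ⊆ O) ∧
        (∀ z ∈ O, ‖Hc z‖ ≤ A * Real.exp (-(R * (domSys (F.P K) M (k + 1)).dj Z))) ∧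
        (∀ t ∈ Ioc (0 : ℝ) θ.γ, Hc t = ((S K) k).H (Function.update g i t) φ Z))
    (hlast : ∀ (K k : ℕ), ∀ g ∈ box θ.γ k, ∀ t ∈ Ioc (0 : ℝ) θ.γ, ∀ (X : (domSys (F.P K) M (k + 1)).Dom), ∀ φ ∈ sp K k X,
      ‖((S K) k).E g φ X - ((S K) k).E (Function.update g (Fin.last k) t) φ X‖ ≤ ΛE * Real.exp (-(κ * torusTreeLen X.1)) * |g (Fin.last k) - t|)
    (hAn : ∀ K k, ((S K) k).AnalyticH (box θ.γ k) (sp K k))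
    (Ec : ℕ → ℕ → Type*) [∀ K k, NormedAddCommGroup (Ec K k)] [∀ K k, NormedSpace ℂ (Ec K k)]
    (ι : letI := θ.instVβ₁; letI := θ.instVβ₂
      (K k : ℕ) → (domSys (F.P K) M (k + 1)).Dom → ((Fin (F.P K).d → Site (F.P K) (k + 1) → θ.Vβ) →L[ℝ] Ec K k))
    (Φ : (K k : ℕ) → (domSys (F.P K) M (k + 1)).Dom → Ec K k → CPair (F.P K) 𝔸)
    (U : (K k : ℕ) → (domSys (F.P K) M (k + 1)).Dom → Set (Ec K k)) (hU : ∀ K k X, IsOpen (U K k X)) (hrU : ∀ K k X, ball (0 : Ec K k) r ⊆ U K k X)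
    (hΦhol : ∀ (K k : ℕ) (X : (domSys (F.P K) M (k + 1)).Dom), DifferentiableOn ℂ (Φ K k X) (U K k X))
    (hΦemb : letI := θ.instVβ₁; letI := θ.instVβ₂
      ∀ (K k : ℕ) (X : (domSys (F.P K) M (k + 1)).Dom) (B : Fin (F.P K).d → Site (F.P K) (k + 1) → θ.Vβ),
        Φ K k X (ι K k X B) = emb K k (fun l t => NormedSpace.exp (θ.ρ8 (B l t))))
    (hΦsp : ∀ (K k : ℕ) (X : (domSys (F.P K) M (k + 1)).Dom), ∀ z ∈ U K k X, ∀ Z : (domSys (F.P K) M (k + 1)).Dom, Z.1 ⊆ X.1 → Φ K k X z ∈ sp K k Z)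
    (w : (K k : ℕ) → (domSys (F.P K) M (k + 1)).Dom → Site (F.P K) (k + 1) → ℝ) (hw₀ : ∀ K k X t, 0 ≤ w K k X t)
    (hw : letI := θ.instVβ₁; letI := θ.instVβ₂; letI := θ.instιβ
      ∀ (K k : ℕ) (X : (domSys (F.P K) M (k + 1)).Dom) (l : Fin (F.P K).d) (t : Site (F.P K) (k + 1)) (c : θ.ιβ),
        ‖ι K k X (Pi.single l (Pi.single t (θ.bV c)))‖ ≤ w K k X t)
    (htail : ∀ (K k : ℕ) (X : (domSys (F.P K) M (k + 1)).Dom) (t : Site (F.P K) (k + 1)),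
      let e : Site (F.P K) (k + 1) → TPt 4 (domCount (F.P K) M (k + 1) * M) := fun x i => (ZMod.cast (x i) : ZMod (domCount (F.P K) M (k + 1) * M))
      w K k X t ≤ B₃ * Real.exp (-δ₀ * distCT (domCount (F.P K) M (k + 1)) M (e t) (nearT (M := M) (e t) X)))
    (hℓκ : ℓ.κ ≤ delta1 δ₀ κ ((M : ℝ) * 4))
    (hdom : ∀ n i, 16 * B₃ ^ 2 / r ^ 2 * Real.exp (delta1 δ₀ κ ((M : ℝ) * 4) * ((M : ℝ) * 4) * 3) * K₀ (4 * 2 ^ 4) (2 * 4) * K₁ 4 (δ₀ / 2) *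
        (if i + 1 < n then 8 * (Real.exp 1 * 9 * 64 * K₀ 64 8 ^ 2) * (4 * A / ϱt n i) else ΛE) ≤ ℓ.moduli n i) :
    NE9 ((objectsOfRecord₁₃ F N θ ℓ).EA 0) (Window θ.γ) ℓ.κ ℓ.moduli := by
  letI := θ.instVβ₁; letI := θ.instVβ₂; letI := θ.instιβ
  exact ne9_EA_objectsOfRecord₁₃_of_windowedLetter F N θ ℓ hs hlim S emb hloc
    (windowedNE9_localizedSum_of_olderCoordHolo_lastLetter F m' M hM S emb θ.ρ8 θ.bV (Window θ.γ) subset_rfl sp ϱt hϱt hA hr₁ hκ hκ₀ hrate hsmall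
      hδ₀ hB₃ hr hΛE h238 hO hlast Ec ι Φ U hU hrU
      (fun g hg K k X => differentiableOn_H_comp_of_analyticH ((S K) k) (box θ.γ k) (sp K k) (hAn K k) (histPrefix_mem_box hg k) (Φ K k X)
        (hΦhol K k X) X (hΦsp K k X))
      hΦemb hΦsp w hw₀ hw htail)
    hℓκ hdom

open Classical in
/-- ★★★ **THE N22 PIN FACE FROM J33's (β′) LETTER AT THE RECORD**, every run length `k`, under `hpin` — `ne9_EA_objectsOfRecord₁₃_of_olderCoordHolo_lastLetter_analyticH` fed to dag-n22-w3's
`n22At_rateCarriers_of_kernels_pin_of_ne9`.  LOCATED (hypothesis form); N22 NOT discharged. -/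
theorem n22At_rateCarriers_of_kernels_pin_of_olderCoordHolo_lastLetter_analyticH (𝔯 : RateReading₁₃CoPH N) (θ : Stage13HParams F N)
    (hP : θ.Provisos₁₃CoPH F N) (g₀ : ℕ → ℝ) (os : List (ULoop F)) (ℓ : U3Letters₁₁) (hs : ℓ.Signs)
    (hpin : (𝔯.lit F θ hP g₀ os).u3 = objectsOfRecord₁₃ F N θ.toStage13Params ℓ) (hlim : PolLimitsExistOfRecord₁₃ F N θ.toStage13Params)
    {𝔸 : Type*} [NormedRing 𝔸] [NormedAlgebra ℂ 𝔸] (m' : ℕ) (M : ℕ) [NeZero M] (hM : M = F.L ^ m')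
    (S : (K : ℕ) → ClusterTower (F.P K) 𝔸 M) (emb : ReadingMaps F (MatA N) 𝔸) (hloc : Localizes17OfRecord₁₃ F N θ.toStage13Params S emb)
    (sp : (K k : ℕ) → (domSys (F.P K) M (k + 1)).Dom → Set (CPair (F.P K) 𝔸))
    {A R r₁ κ δ₀ B₃ r ΛE : ℝ} (ϱt : ℕ → ℕ → ℝ) (hϱt : ∀ n i, 0 < ϱt n i)
    (hA : 0 < A) (hr₁ : 0 ≤ r₁) (hκ : κ ≤ r₁) (hκ₀ : kappa₀ (4 * 2 ^ 4) (2 * 4) ≤ κ / 2) (hrate : r₁ + 2 * (64 * Real.log 162) + 2 ≤ R)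
    (hsmall : 2 * A * Real.exp (5 * r₁ + 1) * K₀ 64 8 * 9 * 64 ≤ 1) (hδ₀ : 0 < δ₀) (hB₃ : 0 ≤ B₃) (hr : 0 < r) (hΛE : 0 ≤ ΛE)
    (h238 : ∀ K k, ((S K) k).Bound238 (box θ.γ k) (sp K k) A R)
    (hO : ∀ (K k : ℕ), ∀ g ∈ box θ.γ k, ∀ (Z : (domSys (F.P K) M (k + 1)).Dom), ∀ φ ∈ sp K k Z, ∀ i : Fin (k + 1), (i : ℕ) < k →
      ∃ (Hc : ℂ → ℂ) (O : Set ℂ), DifferentiableOn ℂ Hc O ∧ (∀ t ∈ Ioc (0 : ℝ) θ.γ, closedBall (t : ℂ) (ϱt (k + 1) i) ⊆ O) ∧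
        (∀ z ∈ O, ‖Hc z‖ ≤ A * Real.exp (-(R * (domSys (F.P K) M (k + 1)).dj Z))) ∧
        (∀ t ∈ Ioc (0 : ℝ) θ.γ, Hc t = ((S K) k).H (Function.update g i t) φ Z))
    (hlast : ∀ (K k : ℕ), ∀ g ∈ box θ.γ k, ∀ t ∈ Ioc (0 : ℝ) θ.γ, ∀ (X : (domSys (F.P K) M (k + 1)).Dom), ∀ φ ∈ sp K k X,
      ‖((S K) k).E g φ X - ((S K) k).E (Function.update g (Fin.last k) t) φ X‖ ≤ ΛE * Real.exp (-(κ * torusTreeLen X.1)) * |g (Fin.last k) - t|)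
    (hAn : ∀ K k, ((S K) k).AnalyticH (box θ.γ k) (sp K k))
    (Ec : ℕ → ℕ → Type*) [∀ K k, NormedAddCommGroup (Ec K k)] [∀ K k, NormedSpace ℂ (Ec K k)]
    (ι : letI := θ.instVβ₁; letI := θ.instVβ₂
      (K k : ℕ) → (domSys (F.P K) M (k + 1)).Dom → ((Fin (F.P K).d → Site (F.P K) (k + 1) → θ.Vβ) →L[ℝ] Ec K k))
    (Φ : (K k : ℕ) → (domSys (F.P K) M (k + 1)).Dom → Ec K k → CPair (F.P K) 𝔸)
    (U : (K k : ℕ) → (domSys (F.P K) M (k + 1)).Dom → Set (Ec K k)) (hU : ∀ K k X, IsOpen (U K k X)) (hrU : ∀ K k X, ball (0 : Ec K k) r ⊆ U K k X)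
    (hΦhol : ∀ (K k : ℕ) (X : (domSys (F.P K) M (k + 1)).Dom), DifferentiableOn ℂ (Φ K k X) (U K k X))
    (hΦemb : letI := θ.instVβ₁; letI := θ.instVβ₂
      ∀ (K k : ℕ) (X : (domSys (F.P K) M (k + 1)).Dom) (B : Fin (F.P K).d → Site (F.P K) (k + 1) → θ.Vβ),
        Φ K k X (ι K k X B) = emb K k (fun l t => NormedSpace.exp (θ.ρ8 (B l t))))
    (hΦsp : ∀ (K k : ℕ) (X : (domSys (F.P K) M (k + 1)).Dom), ∀ z ∈ U K k X, ∀ Z : (domSys (F.P K) M (k + 1)).Dom, Z.1 ⊆ X.1 → Φ K k X z ∈ sp K k Z)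
    (w : (K k : ℕ) → (domSys (F.P K) M (k + 1)).Dom → Site (F.P K) (k + 1) → ℝ) (hw₀ : ∀ K k X t, 0 ≤ w K k X t)
    (hw : letI := θ.instVβ₁; letI := θ.instVβ₂; letI := θ.instιβ
      ∀ (K k : ℕ) (X : (domSys (F.P K) M (k + 1)).Dom) (l : Fin (F.P K).d) (t : Site (F.P K) (k + 1)) (c : θ.ιβ),
        ‖ι K k X (Pi.single l (Pi.single t (θ.bV c)))‖ ≤ w K k X t)
    (htail : ∀ (K k : ℕ) (X : (domSys (F.P K) M (k + 1)).Dom) (t : Site (F.P K) (k + 1)),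
      let e : Site (F.P K) (k + 1) → TPt 4 (domCount (F.P K) M (k + 1) * M) := fun x i => (ZMod.cast (x i) : ZMod (domCount (F.P K) M (k + 1) * M))
      w K k X t ≤ B₃ * Real.exp (-δ₀ * distCT (domCount (F.P K) M (k + 1)) M (e t) (nearT (M := M) (e t) X)))
    (hℓκ : ℓ.κ ≤ delta1 δ₀ κ ((M : ℝ) * 4))
    (hdom : ∀ n i, 16 * B₃ ^ 2 / r ^ 2 * Real.exp (delta1 δ₀ κ ((M : ℝ) * 4) * ((M : ℝ) * 4) * 3) * K₀ (4 * 2 ^ 4) (2 * 4) * K₁ 4 (δ₀ / 2) *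
        (if i + 1 < n then 8 * (Real.exp 1 * 9 * 64 * K₀ 64 8 ^ 2) * (4 * A / ϱt n i) else ΛE) ≤ ℓ.moduli n i) (k : ℕ) :
    N22At (rateCarriersOfRecord₁₃CoPH 𝔯 F θ hP g₀ os k).u3 :=
  n22At_rateCarriers_of_kernels_pin_of_ne9 𝔯 θ hP g₀ os ℓ hs hpin
    (ne9_EA_objectsOfRecord₁₃_of_olderCoordHolo_lastLetter_analyticH F N θ.toStage13Params ℓ hs hlim m' M hM S emb hloc sp ϱt hϱt hA hr₁ hκ hκ₀ hrate hsmall hδ₀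
      hB₃ hr hΛE h238 hO hlast hAn Ec ι Φ U hU hrU hΦhol hΦemb hΦsp w hw₀ hw htail hℓκ hdom) k

end YMDAG.N22.AtRecordOfPrintedSlots

end
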